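/-
Origin: expansion seat `planner-pub-hodgecm-toy2-g3-0`, handover #1a 2026-08-18T06:26:03Z (`HOME/pub-hodgecm-toy2-g3/lean/Toy2g3/TruncAlg.lean`, md5 4e3e04df, 365 lines);
landed by the gen-7 packager in gate run 25 as `HodgeCM/Model/TruncAlg.lean` (verbatim).
-/
/-
Copyright: pub-hodgecm formalisation cell (harness21, 2026). New file (not vendored).
Origin: HOME/pub-hodgecm-toy2-g3/lean/Toy2g3/TruncAlg.lean — session planner-pub-hodgecm-toy2-g3-0 (unit pub-hodgecm-toy2-g3,
CONSISTENCY seat 2, part (6a)(i)+(ii), generation 3).  WIP module `Toy2g3.TruncAlg`; intended final place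
`HodgeCM/Model/TruncAlg.lean` (module `HodgeCM.Model.TruncAlg`; kind L5 consistency / non-vacuity layer).  Imports are FINAL
package names; nothing to rewrite.
-/
import Summits.HodgeConjecture.HodgeCM.Model.Inhabited
import Summits.HodgeConjecture.HodgeCM.CM.BalancedHodge
import Summits.HodgeConjecture.HodgeCM.Proofs.Pohlmann.WeightLines
import Summits.HodgeConjecture.HodgeCM.StubTree.Qw8Complement
import Summits.HodgeConjecture.HodgeCM.StubTree.Qw8GysinDescent

/-!
# The codimension-two truncation of a universe: `Qw8Sufficiency`, `FaceReduction` and `HC_CM` carry content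

For ANY geometric universe `U` let `U.truncAlg` be the universe with the SAME varieties, cohomology, Hodge structures,
morphisms, traces, products, CM data and Picard modular surfaces, but with the spans of algebraic classes TRUNCATED at
codimension two:

  `U.truncAlg.alg X p := U.alg X p` for `p ≤ 2`,   `U.truncAlg.alg X p := ⊥` for `p ≥ 3`.

Nothing in the 28 model facts constrains algebraic classes of codimension `≥ 3` except through functoriality (M8), the
Gysin class of a surface (M26, degree `dim X - 2`) and the source side of the algebraic self-duality (M28, degree
`dim P - 2`, where a SMALLER span only helps).  Hence (this file, no hypothesis on `U` beyond the ones named):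

1. `ModelAxioms.truncAlg` — if `U` satisfies the 28 model facts and has `tr = 0` then `U.truncAlg` satisfies the 28 model
   facts (`tr = 0` is used only for M26, with `c := 0`); in general `ModelAxioms.periodFree_truncAlg : U.ModelAxioms →
   U.periodFree.truncAlg.ModelAxioms`.
2. Everything about classes of codimension `≤ 2`, and everything not mentioning `alg`, is LITERALLY unchanged:
   `WeilFaceAlgebraic`, `W_RK4`, `PohlmannSpan`, `PohlmannBasis`, the weight spaces, the facts N1–N4, F5 `Fact_cupAssoc`,
   `Fact_dimProd`; and F7d `Fact_gysinDescent` is INHERITED (`Fact_gysinDescent.truncAlg`).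
3. `HC X` FAILS in `U.truncAlg` for every `X` with a nonzero Hodge class of codimension `≥ 3`; under `ModelAxioms` + N1–N4
   such an `X` exists among the CM abelian varieties: `A_{(F,Φ)}` for `F = ℚ(ζ₇)` (`HodgeCM.faceHypothesesInhabited`), whose
   top class spans the weight LINE of the full weight (`finrank_weightSpace`, a Hodge weight by `lefChar_univ_eq_zero`),
   inside `B^3 ⊗ ℂ` by Pohlmann's theorem (`pohlmannBasis_of_facts`).  So `¬ U.truncAlg.HC_CM`,
   `¬ U.truncAlg.FaceReduction` (given `U.W_RK4`), `U.truncAlg.Lemma81` (vacuously), and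
4. `¬ U.truncAlg.Qw8Sufficiency` (given `ModelAxioms`, N1 and `U.W_RK4`): all faces of `ℚ(ζ₇)` stay algebraic (codimension 2),
   the top class of `A_{(ℚ(ζ₇),Φ)}` is a weight vector of a Hodge weight whose Lefschetz character is `0` (the empty
   combination of face characters), and it is NOT in `Alg^3 ⊗ ℂ = 0`.

CONSEQUENCE (`exists_model_separating_qw8Sufficiency`, and `HodgeCM.Model.Toy.ToyTruncAlg` for the unconditional instance
`toyModel.truncAlg`): if some universe satisfies `ModelAxioms`, N1–N4, `W_RK4` and `PohlmannSpan`, then some universe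
satisfies `ModelAxioms ∧ PohlmannSpan ∧ PohlmannBasis ∧ W_RK4 ∧ Lemma81` and REFUTES `Qw8Sufficiency`, `FaceReduction` and
`HC_CM`.  So in the assembly `COR_CM_holds (M) (I)` the input `I.qw8_sufficiency` ([QW8] Thm 2.5 + §3 + Milne 1999) is
load-bearing even granting the OUTPUT `W_RK4` of the two realisation inputs and Pohlmann's theorem: the 28 model facts,
Pohlmann's span theorem and the algebraicity of every rank-four face line do not imply the Hodge conjecture for CM
abelian varieties.  Of the generic fact list of the [QW8] route (`Assembly.COR_CM_of_descentFacts`: N1–N4, F4, F5, F7d,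
`Fact_dimProd`) exactly F4 `Fact_cupAlg` (cup products of algebraic classes are algebraic in ALL degrees) fails under
truncation (`not_fact_cupAlg_truncAlg`); M9 `Fact_cup_alg` (degree `1 + 1`) survives.  (This says nothing about the
INTENDED model, where `alg` is the span of cycle classes and F4 is Fulton Cor. 19.2(b).)
-/

noncomputable section

open scoped TensorProduct

namespace HodgeCM

open Literature.AlgebraicGeometry.Motives (CMType)

namespace Universe

variable (U : Universe)

/-! ### The truncation -/

/-- The **codimension-two truncation** of `U`: all primitives of `U` unchanged except the spans of algebraic classes,
which are kept in codimension `≤ 2` and replaced by `0` in codimension `≥ 3`. -/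
def truncAlg : Universe := { U with alg := fun X p => if p ≤ 2 then U.alg X p else ⊥ }

/-- (Ported verbatim from the HodgeCMPerL package; no docstring in the source.) -/
theorem truncAlg_alg (X : U.Var) (p : ℕ) : U.truncAlg.alg X p = if p ≤ 2 then U.alg X p else ⊥ := rfl

/-- (Ported verbatim from the HodgeCMPerL package; no docstring in the source.) -/
theorem truncAlg_alg_of_le {X : U.Var} {p : ℕ} (hp : p ≤ 2) : U.truncAlg.alg X p = U.alg X p := if_pos hp

/-- (Ported verbatim from the HodgeCMPerL package; no docstring in the source.) -/
theorem truncAlg_alg_of_lt {X : U.Var} {p : ℕ} (hp : 2 < p) : U.truncAlg.alg X p = ⊥ := if_neg (not_le.mpr hp)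

/-- (Ported verbatim from the HodgeCMPerL package; no docstring in the source.) -/
theorem truncAlg_alg_le (X : U.Var) (p : ℕ) : U.truncAlg.alg X p ≤ U.alg X p := by
  rw [truncAlg_alg]
  split_ifs
  · exact le_rfl
  · exact bot_le

/-- (Ported verbatim from the HodgeCMPerL package; no docstring in the source.) -/
@[simp] theorem truncAlg_tr (X : U.Var) (k : ℕ) : U.truncAlg.tr X k = U.tr X k := rfl

/-- (Ported verbatim from the HodgeCMPerL package; no docstring in the source.) -/
theorem truncAlg_hodgeClassesOf (X : U.Var) (p : ℕ) : U.truncAlg.hodgeClassesOf X p = U.hodgeClassesOf X p := rfl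

/-- (Ported verbatim from the HodgeCMPerL package; no docstring in the source.) -/
theorem truncAlg_algC_of_lt {X : U.Var} {p : ℕ} (hp : 2 < p) : U.truncAlg.algC X p = ⊥ := by
  rw [algC, truncAlg_alg_of_lt U hp, Submodule.baseChange_bot]

/-! ### The 28 model facts survive truncation (when `tr = 0`) -/

/- `cmProd F Θ = prodFin n …` is defined by structural recursion on `n`; with `n` a variable the elaborator's smart
unfolding refuses to unfold it, so the literal identities below are checked with `smartUnfolding false`. -/
set_option smartUnfolding false in
/-- (Ported verbatim from the HodgeCMPerL package; no docstring in the source.) -/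
theorem truncAlg_fact_cmDominated_iff : U.truncAlg.Fact_cmDominated ↔ U.Fact_cmDominated := Iff.rfl

/-- **The 28 model facts survive the codimension-two truncation** of a universe with vanishing traces (`tr = 0` is used
only for M26 `Fact_gysin_surface`, witnessed by `c := 0`; M28 `Fact_algDuality` holds with the same `D`, since its source
span only shrinks and its target span, of codimension `2`, is unchanged). -/
theorem ModelAxioms.truncAlg {U : Universe} (M : U.ModelAxioms) (h0 : ∀ (X : U.Var) (k : ℕ), U.tr X k = 0) :
    U.truncAlg.ModelAxioms where
  pull_id := M.pull_id
  pull_comp := M.pull_comp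
  pull_cup := M.pull_cup
  pull_hodge := M.pull_hodge
  cup2_hodge := M.cup2_hodge
  tr_degree := M.tr_degree
  alg_le_hodge := fun X p => (U.truncAlg_alg_le X p).trans (M.alg_le_hodge X p)
  pull_alg := fun X Y f p => by
    show (U.truncAlg.alg Y p).map (U.pull f (2 * p)) ≤ U.truncAlg.alg X p
    rw [truncAlg_alg, truncAlg_alg]
    split_ifs
    · exact M.pull_alg X Y f p
    · rw [Submodule.map_bot]
  cup_alg := fun X x y hx hy => by
    show U.cup X 2 2 x y ∈ U.truncAlg.alg X 2
    rw [U.truncAlg_alg_of_le (le_refl 2)]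
    rw [U.truncAlg_alg_of_le (by norm_num : 1 ≤ 2)] at hx hy
    exact M.cup_alg X x y hx hy
  lefschetz11 := fun X => by
    show U.hodgeClassesOf X 1 ≤ U.truncAlg.alg X 1
    rw [U.truncAlg_alg_of_le (by norm_num : 1 ≤ 2)]
    exact M.lefschetz11 X
  cmAV := M.cmAV
  eigenLine := M.eigenLine
  alphaLine := M.alphaLine
  cmDominated := U.truncAlg_fact_cmDominated_iff.mpr M.cmDominated
  weilLine_rank := M.weilLine_rank
  weilLine_hodge := M.weilLine_hodge
  pms_dim := M.pms_dim
  lift := M.lift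
  cup_comm1 := M.cup_comm1
  cup_interchange := M.cup_interchange
  kunneth1 := M.kunneth1
  H1_rank := M.H1_rank
  H4_span := M.H4_span
  cmEnd := M.cmEnd
  conjIsogeny := M.conjIsogeny
  gysin_surface := fun S X f _ => ⟨0, Submodule.zero_mem _, fun y => by
    show U.tr S 4 _ = U.tr X _ _
    rw [h0, h0, LinearMap.zero_apply, LinearMap.zero_apply]⟩
  deg_diag := M.deg_diag
  algDuality := fun K Φ => by
    obtain ⟨D, hD, halg, hint⟩ := M.algDuality K Φ
    refine ⟨D, hD, ?_, hint⟩
    show (U.truncAlg.alg _ _).map D ≤ U.truncAlg.alg _ 2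
    rw [U.truncAlg_alg_of_le (le_refl 2)]
    exact (Submodule.map_mono (U.truncAlg_alg_le _ _)).trans halg

/-- In particular the truncation of the period-free shadow of ANY model is a model. -/
theorem ModelAxioms.periodFree_truncAlg {U : Universe} (M : U.ModelAxioms) : U.periodFree.truncAlg.ModelAxioms :=
  ModelAxioms.truncAlg (ModelAxioms.periodFree U M) (fun _ _ => rfl)

/-! ### Statements about codimension `≤ 2`, and statements not mentioning `alg`, are unchanged -/

/-- (Ported verbatim from the HodgeCMPerL package; no docstring in the source.) -/
theorem truncAlg_weilFaceAlgebraic_iff (K : CMField) (f : Face K) :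
    U.truncAlg.WeilFaceAlgebraic K f ↔ U.WeilFaceAlgebraic K f := by
  show U.weilLine K f.corner ≤ U.truncAlg.alg _ 2 ↔ _
  rw [U.truncAlg_alg_of_le (le_refl 2)]
  rfl

/-- (Ported verbatim from the HodgeCMPerL package; no docstring in the source.) -/
theorem truncAlg_w_rk4_iff : U.truncAlg.W_RK4 ↔ U.W_RK4 :=
  forall₃_congr fun _ _ _ => forall_congr' fun f => U.truncAlg_weilFaceAlgebraic_iff _ f

set_option smartUnfolding false in
/-- (Ported verbatim from the HodgeCMPerL package; no docstring in the source.) -/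
theorem truncAlg_pohlmannSpan_iff : U.truncAlg.PohlmannSpan ↔ U.PohlmannSpan := Iff.rfl
set_option smartUnfolding false in
/-- (Ported verbatim from the HodgeCMPerL package; no docstring in the source.) -/
theorem truncAlg_pohlmannBasis_iff : U.truncAlg.PohlmannBasis ↔ U.PohlmannBasis := Iff.rfl
set_option smartUnfolding false in
/-- (Ported verbatim from the HodgeCMPerL package; no docstring in the source.) -/
theorem truncAlg_weightSpace (F : CMField) {n : ℕ} (Θ : Fin (n + 1) → CMType F)
    (S : Fin (n + 1) → Finset ((F : Type) →+* ℂ)) (k : ℕ) :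
    U.truncAlg.weightSpace F Θ S k = U.weightSpace F Θ S k := rfl
set_option smartUnfolding false in
/-- (Ported verbatim from the HodgeCMPerL package; no docstring in the source.) -/
theorem truncAlg_fact_cupExterior_iff : U.truncAlg.Fact_cupExterior ↔ U.Fact_cupExterior := Iff.rfl
/-- (Ported verbatim from the HodgeCMPerL package; no docstring in the source.) -/
theorem truncAlg_fact_cup_hodge_iff : U.truncAlg.Fact_cup_hodge ↔ U.Fact_cup_hodge := Iff.rfl
/-- (Ported verbatim from the HodgeCMPerL package; no docstring in the source.) -/
theorem truncAlg_fact_pull_H0_iff : U.truncAlg.Fact_pull_H0 ↔ U.Fact_pull_H0 := Iff.rfl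
/-- (Ported verbatim from the HodgeCMPerL package; no docstring in the source.) -/
theorem truncAlg_fact_hodge_F0_iff : U.truncAlg.Fact_hodge_F0 ↔ U.Fact_hodge_F0 := Iff.rfl
/-- (Ported verbatim from the HodgeCMPerL package; no docstring in the source.) -/
theorem truncAlg_fact_cupAssoc_iff : U.truncAlg.Fact_cupAssoc ↔ U.Fact_cupAssoc := Iff.rfl
/-- (Ported verbatim from the HodgeCMPerL package; no docstring in the source.) -/
theorem truncAlg_fact_dimProd_iff : U.truncAlg.Fact_dimProd ↔ U.Fact_dimProd := Iff.rfl
-- The period-free shadow does not change the four textbook facts N1–N4 either.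
set_option smartUnfolding false in
/-- (Ported verbatim from the HodgeCMPerL package; no docstring in the source.) -/
theorem periodFree_fact_cupExterior_iff : U.periodFree.Fact_cupExterior ↔ U.Fact_cupExterior := Iff.rfl
/-- (Ported verbatim from the HodgeCMPerL package; no docstring in the source.) -/
theorem periodFree_fact_cup_hodge_iff : U.periodFree.Fact_cup_hodge ↔ U.Fact_cup_hodge := Iff.rfl
/-- (Ported verbatim from the HodgeCMPerL package; no docstring in the source.) -/
theorem periodFree_fact_pull_H0_iff : U.periodFree.Fact_pull_H0 ↔ U.Fact_pull_H0 := Iff.rfl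
/-- (Ported verbatim from the HodgeCMPerL package; no docstring in the source.) -/
theorem periodFree_fact_hodge_F0_iff : U.periodFree.Fact_hodge_F0 ↔ U.Fact_hodge_F0 := Iff.rfl

set_option smartUnfolding false in
/-- **F7d `Fact_gysinDescent` is inherited by the truncation**: clause (a) does not mention `alg`; in clause (b), if the
target codimension `p + dim Y'` is `≤ 2` nothing changed, and otherwise the hypothesis says the mixed product vanishes,
so `e = 0` by clause (a). -/
theorem Fact_gysinDescent.truncAlg (h : U.Fact_gysinDescent) : U.truncAlg.Fact_gysinDescent := by
  intro F n m Ξ pA pB hP ω hω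
  obtain ⟨ha, hb⟩ := h F n m Ξ pA pB hP ω hω
  refine ⟨ha, fun p e he => ?_⟩
  by_cases hp : p + U.truncAlg.dim (U.truncAlg.cmProd F (blkB Ξ)) ≤ 2
  · have he' := he
    rw [U.truncAlg_alg_of_le hp] at he'
    show e ∈ U.truncAlg.alg _ p
    rw [U.truncAlg_alg_of_le (by omega)]
    exact hb p e he'
  · have he' := he
    rw [U.truncAlg_alg_of_lt (by omega), Submodule.mem_bot, LinearEquiv.map_eq_zero_iff] at he'
    have h0 : e = 0 := ha (2 * p) e he'
    rw [h0]
    exact Submodule.zero_mem _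

/-! ### `HC` fails in the truncation for every variety with a Hodge class of codimension `≥ 3` -/

variable {U}

/-- (Ported verbatim from the HodgeCMPerL package; no docstring in the source.) -/
theorem not_hc_truncAlg_of_ne_bot {X : U.Var} {p : ℕ} (hp : 2 < p) (h : U.hodgeClassesOf X p ≠ ⊥) :
    ¬ U.truncAlg.HC X := by
  intro hc
  have h1 : U.hodgeClassesOf X p ≤ U.truncAlg.alg X p := hc p
  rw [U.truncAlg_alg_of_lt hp] at h1
  have h2 : U.hodgeClassesOf X p ≤ (⊥ : Submodule ℚ (U.Coh X (2 * p))) := h1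
  exact h (eq_bot_iff.mpr h2)

/-! ### The witness: the top class of `A_{(F,Φ)}`, `F` Galois of degree `≥ 6` -/

section Witness

variable {F : CMField}

/-- The full weight `(Hom(F,ℂ))` on the single factor `A_{(F,Φ)}` is a Hodge weight of degree `[F:ℚ]/2` (its
Lefschetz character is `0`: `lefChar_univ_eq_zero`). -/
theorem isHodgeWeight_univ_single (Φ : CMType F) :
    IsHodgeWeight (fun _ : Fin (0 + 1) => Φ) (Module.finrank ℚ F / 2) (fun _ => Finset.univ) := by
  have h := isHodgeWeight_of_lefChar_eq_zero (F := (F : Type)) (fun _ : Fin (0 + 1) => Φ) (fun _ => Finset.univ)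
    (lefChar_univ_eq_zero _)
  simpa only [Fin.sum_univ_succ, Fin.sum_univ_zero, add_zero, Finset.card_univ, NumberField.Embeddings.card] using h

/-- (Ported verbatim from the HodgeCMPerL package; no docstring in the source.) -/
theorem two_mul_finrank_div_two (Φ : CMType F) : 2 * (Module.finrank ℚ F / 2) = Module.finrank ℚ F := by
  have h := (isHodgeWeight_univ_single Φ).1
  simp only [Fin.sum_univ_succ, Fin.sum_univ_zero, add_zero, Finset.card_univ, NumberField.Embeddings.card] at h
  omega

/-- **The weight line of the full weight is nonzero** (`ModelAxioms` + N1: `dim_ℂ V_{univ} = 1` in degree `[F:ℚ]`):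
there is a nonzero weight vector of the full weight on `A_{(F,Φ)}` in degree `2 · ([F:ℚ]/2)`. -/
theorem exists_weightVector_univ_single (M : U.ModelAxioms) (hN1 : U.Fact_cupExterior) (h6 : 6 ≤ Module.finrank ℚ F)
    (Φ : CMType F) :
    ∃ x ∈ U.weightSpace F (fun _ : Fin (0 + 1) => Φ) (fun _ => Finset.univ) (2 * (Module.finrank ℚ F / 2)), x ≠ 0 := by
  have hS := isHodgeWeight_univ_single Φ
  have h1 : Module.finrank ℂ
      (U.weightSpace F (fun _ : Fin (0 + 1) => Φ) (fun _ => Finset.univ) (2 * (Module.finrank ℚ F / 2))) = 1 :=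
    finrank_weightSpace_of_isHodgeWeight M hN1 (by omega) hS
  have hne : U.weightSpace F (fun _ : Fin (0 + 1) => Φ) (fun _ => Finset.univ) (2 * (Module.finrank ℚ F / 2)) ≠ ⊥ := by
    intro hbot
    rw [hbot, finrank_bot] at h1
    exact zero_ne_one h1
  exact Submodule.exists_mem_ne_zero_of_ne_bot hne

/-- **`B^{[F:ℚ]/2}(A_{(F,Φ)}) ≠ 0`** for `F` Galois (`ModelAxioms` + N1–N4, via Pohlmann's theorem `B^p ⊗ ℂ = ⨆_{S Hodge} V_S`). -/
theorem hodgeClassesOf_single_ne_bot (M : U.ModelAxioms) (hN1 : U.Fact_cupExterior) (hN2 : U.Fact_cup_hodge)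
    (hN3 : U.Fact_pull_H0) (hN4 : U.Fact_hodge_F0) [IsGalois ℚ F] (h6 : 6 ≤ Module.finrank ℚ F) (Φ : CMType F) :
    U.hodgeClassesOf (U.cmProd F (fun _ : Fin (0 + 1) => Φ)) (Module.finrank ℚ F / 2) ≠ ⊥ := by
  intro hbot
  obtain ⟨x, hx, hx0⟩ := exists_weightVector_univ_single M hN1 h6 Φ
  have hB := pohlmannBasis_of_facts M hN1 hN2 hN3 hN4 F ‹_› 0 (fun _ : Fin (0 + 1) => Φ) (Module.finrank ℚ F / 2)
  rw [hbot, Submodule.baseChange_bot] at hB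
  have hx' : x ∈ (⊥ : Submodule ℂ _) := by
    rw [hB]
    exact Submodule.mem_iSup_of_mem _ (Submodule.mem_iSup_of_mem (isHodgeWeight_univ_single Φ) hx)
  exact hx0 ((Submodule.mem_bot ℂ).mp hx')

/-- **`HC(A_{(F,Φ)})` fails in the truncation** (`F` Galois of degree `≥ 6`; `ModelAxioms` + N1–N4 for `U`). -/
theorem not_hc_single_truncAlg (M : U.ModelAxioms) (hN1 : U.Fact_cupExterior) (hN2 : U.Fact_cup_hodge)
    (hN3 : U.Fact_pull_H0) (hN4 : U.Fact_hodge_F0) [IsGalois ℚ F] (h6 : 6 ≤ Module.finrank ℚ F) (Φ : CMType F) :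
    ¬ U.truncAlg.HC (U.cmProd F (fun _ : Fin (0 + 1) => Φ)) :=
  not_hc_truncAlg_of_ne_bot (by omega) (hodgeClassesOf_single_ne_bot M hN1 hN2 hN3 hN4 h6 Φ)

end Witness

/-! ### The separations -/

section Separation

variable (M : U.ModelAxioms) (hN1 : U.Fact_cupExterior) (hN2 : U.Fact_cup_hodge) (hN3 : U.Fact_pull_H0)
  (hN4 : U.Fact_hodge_F0)
include M hN1

/-- **`Qw8Sufficiency` FAILS in the truncation** of a model with N1 in which every rank-four face line is algebraic:
for `F = ℚ(ζ₇)` all faces stay algebraic (codimension `2`), the top class of `A_{(F,Φ)}` is a nonzero weight vector of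
the full weight — a Hodge weight with Lefschetz character `0 = Σ_{i < 0} …` — and `Alg^3(A_{(F,Φ)}) ⊗ ℂ = 0`. -/
theorem not_qw8Sufficiency_truncAlg (hW : U.W_RK4) : ¬ U.truncAlg.Qw8Sufficiency := by
  intro hQ
  obtain ⟨F, hG, h6, f, ι₁, -⟩ := HodgeCM.faceHypothesesInhabited
  haveI := hG
  obtain ⟨x, hx, hx0⟩ := exists_weightVector_univ_single M hN1 h6 f.Φ
  have hfaces : ∀ f' : Face F, U.truncAlg.WeilFaceAlgebraic F f' :=
    fun f' => (U.truncAlg_weilFaceAlgebraic_iff F f').mpr (hW F hG h6 f')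
  have hx' : U.truncAlg.IsWeightVector F (fun _ : Fin (0 + 1) => f.Φ) (fun _ => Finset.univ)
      (2 * (Module.finrank ℚ F / 2)) x := by
    rw [← mem_weightSpace_iff, truncAlg_weightSpace]
    exact hx
  have hmem := hQ F hG h6 hfaces 0 (fun _ => f.Φ) (Module.finrank ℚ F / 2) (fun _ => Finset.univ) x
    (isHodgeWeight_univ_single f.Φ) hx'
    ⟨ι₁, 0, Fin.elim0, Fin.elim0, by rw [lefChar_univ_eq_zero, Finset.univ_eq_empty, Finset.sum_empty]⟩
  rw [U.truncAlg_algC_of_lt (by omega), Submodule.mem_bot] at hmem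
  exact hx0 hmem

include hN2 hN3 hN4

/-- **`HC_CM` FAILS in the truncation** of a model with N1–N4. -/
theorem not_hc_cm_truncAlg : ¬ U.truncAlg.HC_CM := by
  obtain ⟨F, hG, h6, f, -⟩ := HodgeCM.faceHypothesesInhabited
  haveI := hG
  intro h
  exact not_hc_single_truncAlg M hN1 hN2 hN3 hN4 h6 f.Φ (h _ (M.cmAV F f.Φ).2.1)

/-- **`FaceReduction` FAILS in the truncation** of a model with N1–N4 in which every rank-four face line is algebraic. -/
theorem not_faceReduction_truncAlg (hW : U.W_RK4) : ¬ U.truncAlg.FaceReduction := by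
  obtain ⟨F, hG, h6, f, -⟩ := HodgeCM.faceHypothesesInhabited
  haveI := hG
  intro h
  exact not_hc_single_truncAlg M hN1 hN2 hN3 hN4 h6 f.Φ
    (h F hG h6 (fun f' => (U.truncAlg_weilFaceAlgebraic_iff F f').mpr (hW F hG h6 f')) 0 (fun _ => f.Φ))

/-- `Lemma81` (rfwf Lemma 8.2, global form) holds in the truncation — vacuously: its hypothesis fails at `A_{(ℚ(ζ₇),Φ)}`. -/
theorem lemma81_truncAlg : U.truncAlg.Lemma81 := by
  obtain ⟨F, hG, h6, f, -⟩ := HodgeCM.faceHypothesesInhabited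
  haveI := hG
  intro h
  exact absurd (h F hG h6 0 (fun _ => f.Φ)) (not_hc_single_truncAlg M hN1 hN2 hN3 hN4 h6 f.Φ)

/-- **F4 `Fact_cupAlg` FAILS in the truncation** of a model with N1–N4, F5, F7d, `Fact_dimProd` and `W_RK4` — because the
generic [QW8] route `qw8Sufficiency_of_descentFacts` would otherwise prove `Qw8Sufficiency` there. -/
theorem not_fact_cupAlg_truncAlg (h5 : U.Fact_cupAssoc) (h7d : U.Fact_gysinDescent) (hd : U.Fact_dimProd)
    (hW : U.W_RK4) (h0 : ∀ (X : U.Var) (k : ℕ), U.tr X k = 0) : ¬ U.truncAlg.Fact_cupAlg := fun h4 =>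
  not_qw8Sufficiency_truncAlg M hN1 hW
    (qw8Sufficiency_of_descentFacts (M.truncAlg h0) ((U.truncAlg_fact_cupExterior_iff).mpr hN1)
      ((U.truncAlg_fact_cup_hodge_iff).mpr hN2) ((U.truncAlg_fact_pull_H0_iff).mpr hN3)
      ((U.truncAlg_fact_hodge_F0_iff).mpr hN4) h4 ((U.truncAlg_fact_cupAssoc_iff).mpr h5)
      (Fact_gysinDescent.truncAlg U h7d) ((U.truncAlg_fact_dimProd_iff).mpr hd))

end Separation

/-! ### Existence form: a separating model for `qw8_sufficiency` -/

/-- **If the model facts, N1–N4, `W_RK4` and `PohlmannSpan` are jointly satisfiable, then `Qw8Sufficiency` is not a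
consequence of `ModelAxioms ∧ PohlmannSpan ∧ PohlmannBasis ∧ W_RK4 ∧ Lemma81`** — witnessed by the truncation of the
period-free shadow, in which moreover `FaceReduction` and `HC_CM` fail. -/
theorem exists_model_separating_qw8Sufficiency (M : U.ModelAxioms) (hN1 : U.Fact_cupExterior)
    (hN2 : U.Fact_cup_hodge) (hN3 : U.Fact_pull_H0) (hN4 : U.Fact_hodge_F0) (hW : U.W_RK4) (hP : U.PohlmannSpan) :
    ∃ U' : Universe, U'.ModelAxioms ∧ U'.PohlmannSpan ∧ U'.PohlmannBasis ∧ U'.W_RK4 ∧ U'.Lemma81 ∧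
      ¬ U'.Qw8Sufficiency ∧ ¬ U'.FaceReduction ∧ ¬ U'.HC_CM := by
  have M' := ModelAxioms.periodFree U M
  have hN1' : U.periodFree.Fact_cupExterior := (U.periodFree_fact_cupExterior_iff).mpr hN1
  have hN2' : U.periodFree.Fact_cup_hodge := (U.periodFree_fact_cup_hodge_iff).mpr hN2
  have hN3' : U.periodFree.Fact_pull_H0 := (U.periodFree_fact_pull_H0_iff).mpr hN3
  have hN4' : U.periodFree.Fact_hodge_F0 := (U.periodFree_fact_hodge_F0_iff).mpr hN4
  have hW' : U.periodFree.W_RK4 := (U.periodFree_w_rk4_iff).mpr hW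
  refine ⟨U.periodFree.truncAlg, M'.truncAlg (fun _ _ => rfl),
    (U.periodFree.truncAlg_pohlmannSpan_iff).mpr ((U.periodFree_pohlmannSpan_iff).mpr hP),
    (U.periodFree.truncAlg_pohlmannBasis_iff).mpr (pohlmannBasis_of_facts M' hN1' hN2' hN3' hN4'),
    (U.periodFree.truncAlg_w_rk4_iff).mpr hW', lemma81_truncAlg M' hN1' hN2' hN3' hN4',
    not_qw8Sufficiency_truncAlg M' hN1' hW', not_faceReduction_truncAlg M' hN1' hN2' hN3' hN4' hW',
    not_hc_cm_truncAlg M' hN1' hN2' hN3' hN4'⟩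

end Universe

end HodgeCM

end
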